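import Literature.Probability.RandomPlanarGeometry.HexSAWBrickWallHalfSpace
import Literature.Probability.RandomPlanarGeometry.HexSAWBrickWallBridgeEnvelope
import Literature.Probability.RandomPlanarGeometry.SAWBridgeDivergence
import HarnessLib

/-!
# Two decompositions of brick-wall walks of the hexagonal lattice:
# `c_n(ℍ) ≤ Σ_m h_{m+1}(ℍ) h_{n-m}(ℍ)` and the span recursion `h_{n,A} ≤ Σ_m b_{m,A} · h^{<A}_{n-m}`

Topic `Literature/Probability/RandomPlanarGeometry` (continues `HexSAWBrickWallWalks.lean` (`HexBW.saws/bridges/halfSpaceWalks`,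
height = brick-wall coordinate `0`, parity twist `twistAt`), `HexSAWBrickWallBridgeEnvelope.lean` (`HexBW.prep`: prepend a
horizontal step) and `HexSAWBrickWallHalfSpace.lean` (`prefix_mem`, `suffix_mem`)).  Lane «pcv-sawmu», door R84
«HEX-HALFSPACE-RATIO-1», piece K4 (first half: the two combinatorial inequalities of Madras–Slade's proof of
Theorem 3.1.1 / Corollary 3.1.8, transported to the brick wall with the twist).

Source: N. Madras, G. Slade, *The Self-Avoiding Walk* (1993), §3.1: proof of Theorem 3.1.1, eq. (3.1.7) (cut an
`n`-step walk at the LAST minimum of its first coordinate: `c_N ≤ Σ_m h_{m+1} h_{N-m}`), and proof of Corollary 3.1.8,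
eq. (3.1.12), pp. 61–62 (cut a half-space walk at the LAST maximum: head = bridge of span `A`, reflected tail =
half-space walk of span `< A`, "the sequence of bridges uniquely determines the original half-space walk").  The
`ℤ^d` versions are the tree's `Zd.count_le_sum_halfSpaceCount` (`SAWBridges.lean`) and `Zd.card_hsSpan_le`
(`SAWBridgeDivergence.lean`); the honeycomb versions below are not in print (first kernel text).

* `revAt_mem` (the prefix `[0,m]` read backwards from `ω m`, twisted: a brick-wall walk), `prep_mem_halfSpaceWalks`;
* **`hexSawCount_le_sum_halfSpaceCount`** — `c_n(ℍ) ≤ Σ_{m=0}^{n} h_{m+1}(ℍ) · h_{n-m}(ℍ)`;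
* `reflTail_mem`, `maxLevel_reflTail_lt`, `spanHead_mem_bridges`, `eq_of_span_pieces_eq` and
  **`card_hsSpan_le`** — `#{h.s. walks, length n, span A} ≤ Σ_{m=0}^{n} #{bridges, length m, span A} · #{h.s. walks,
  length n-m, span < A}` (`A ≥ 1`; span = `Zd.maxLevel`).
-/

noncomputable section

open Finset Function Literature.Probability.LatticeModels Literature.Probability.Percolation SimpleGraph

namespace Literature.Probability.RandomPlanarGeometry.SAW

namespace HexBW

/-! ### `c_n(ℍ) ≤ Σ_m h_{m+1}(ℍ) h_{n-m}(ℍ)` (Madras–Slade (3.1.7) on the brick wall) -/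

/-- The prefix `[0, m]` of a brick-wall walk read BACKWARDS from `ω m`, re-rooted at the origin and twisted by the
parity of `ω m`: `j ↦ twistAt (ω m) (ω (m - j) - ω m)` (frozen after `m`) is an `m`-step brick-wall walk.
[cite: MadrasSlade1993, §3.1, proof of Theorem 3.1.1, eq. (3.1.7)] -/
theorem revAt_mem {n m : ℕ} {ω : ℕ → Site 2} (hω : ω ∈ saws n) (hm : m ≤ n) :
    (fun j => twistAt (ω m) (ω (m - min j m) - ω m)) ∈ saws m := by
  obtain ⟨-, -, hbw, hinj⟩ := mem_saws_iff.1 hω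
  refine mem_saws_iff.2 ⟨by simp, fun i hi => by simp [min_eq_right hi], ?_, ?_⟩
  · intro i hi
    simp only [min_eq_left hi.le, min_eq_left (by omega : i + 1 ≤ m)]
    refine (adj_twistAt_sub_iff (ω m) _ _).2 ?_
    rw [show m - i = (m - (i + 1)) + 1 by omega]
    exact (hbw (m - (i + 1)) (by omega)).symm
  · intro i hi j hj hij
    simp only [Set.mem_setOf_eq] at hi hj
    simp only [min_eq_left hi, min_eq_left hj] at hij
    have h1 := twistAt_injective (ω m) hij
    rw [sub_left_inj] at h1
    have := hinj (show m - i ≤ n by omega) (show m - j ≤ n by omega) h1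
    omega

/-- Heights along the reversed prefix. [cite: MadrasSlade1993, §3.1, proof of Theorem 3.1.1] -/
theorem revAt_apply_zero (m : ℕ) (ω : ℕ → Site 2) (j : ℕ) :
    (fun j => twistAt (ω m) (ω (m - min j m) - ω m)) j 0 = ω (m - min j m) 0 - ω m 0 := by
  simp only [twistAt_apply_zero, Pi.sub_apply]

/-- **A brick-wall walk staying weakly above its starting height, with a horizontal step prepended, is a half-space
walk** (`prep` of `HexSAWBrickWallBridgeEnvelope.lean`). [cite: MadrasSlade1993, §3.1, proof of Theorem 3.1.1 (the extra step `−e₁`)] -/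
theorem prep_mem_halfSpaceWalks {n : ℕ} {ω : ℕ → Site 2} (hω : ω ∈ saws n) (hlo : ∀ i ≤ n, ω 0 0 ≤ ω i 0) :
    prep ω ∈ halfSpaceWalks (n + 1) := by
  obtain ⟨h0, hend, hbw, hinj⟩ := mem_saws_iff.1 hω
  have h00 : ω 0 0 = 0 := by rw [h0]; rfl
  have hz : (0 : Site 2) 0 = 0 := rfl
  have hpos : ∀ i, 1 ≤ i → i ≤ n + 1 → 1 ≤ prep ω i 0 := fun i h1 h2 => by
    obtain ⟨k, rfl⟩ : ∃ k, i = k + 1 := ⟨i - 1, by omega⟩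
    rw [prep_succ_apply_zero]
    have := hlo k (by omega)
    rw [h00] at this
    linarith
  refine mem_halfSpaceWalks.2 ⟨mem_saws_iff.2 ⟨prep_zero ω, ?_, ?_, ?_⟩, ?_⟩
  · intro i hi
    obtain ⟨k, rfl⟩ : ∃ k, i = k + 1 := ⟨i - 1, by omega⟩
    rw [prep_succ, prep_succ, hend k (by omega)]
  · intro i hi
    rcases Nat.eq_zero_or_pos i with rfl | hipos
    · rw [prep_zero, zero_add, prep_succ, h0, negY_zero]
      exact adj_add_single 0
    · obtain ⟨k, rfl⟩ : ∃ k, i = k + 1 := ⟨i - 1, by omega⟩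
      rw [prep_succ, prep_succ, negY_eq_twistAt_single, negY_eq_twistAt_single]
      exact (adj_twistAt_add_iff _ _ _).2 (hbw k (by omega))
  · intro i hi j hj hij
    simp only [Set.mem_setOf_eq] at hi hj
    rcases Nat.eq_zero_or_pos i with rfl | hipos <;> rcases Nat.eq_zero_or_pos j with rfl | hjpos
    · rfl
    · exfalso
      have h1 := hpos j hjpos hj
      rw [← hij, prep_zero, hz] at h1
      exact absurd h1 (by norm_num)
    · exfalso
      have h1 := hpos i hipos hi
      rw [hij, prep_zero, hz] at h1
      exact absurd h1 (by norm_num)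
    · obtain ⟨k, rfl⟩ : ∃ k, i = k + 1 := ⟨i - 1, by omega⟩
      obtain ⟨l, rfl⟩ : ∃ l, j = l + 1 := ⟨j - 1, by omega⟩
      rw [prep_succ, prep_succ, add_left_inj] at hij
      have := hinj (show k ≤ n by omega) (show l ≤ n by omega) (negY_injective hij)
      omega
  · intro i h1 h2
    rw [prep_zero, hz]
    have := hpos i h1 h2
    linarith

/-- **`c_n(ℍ) ≤ Σ_{m=0}^{n} h_{m+1}(ℍ) · h_{n-m}(ℍ)`** (Madras–Slade (3.1.7) on the hexagonal lattice): cut an `n`-step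
brick-wall walk at the LAST minimum `m` of its height; the twisted piece after `m` is an `(n-m)`-step half-space walk,
the piece up to `m`, read backwards from `ω m` (twisted) and preceded by a horizontal step, is an `(m+1)`-step
half-space walk; `ω` is recovered from `m` and the two pieces (the parity of `ω m` is that of `m`).
[cite: MadrasSlade1993, §3.1, eq. (3.1.7)] -/
theorem hexSawCount_le_sum_halfSpaceCount (n : ℕ) :
    hexSawCount n ≤ ∑ m ∈ Finset.range (n + 1), halfSpaceCount (m + 1) * halfSpaceCount (n - m) := by
  classical
  have hcard : #((Finset.range (n + 1)).sigma fun m => halfSpaceWalks (m + 1) ×ˢ halfSpaceWalks (n - m)) =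
      ∑ m ∈ Finset.range (n + 1), halfSpaceCount (m + 1) * halfSpaceCount (n - m) := by
    rw [Finset.card_sigma]
    simp_rw [Finset.card_product]
    rfl
  rw [← card_saws, ← hcard]
  refine Finset.card_le_card_of_injOn
    (fun ω => (⟨Zd.lastMin n ω, (prep (fun j => twistAt (ω (Zd.lastMin n ω)) (ω (Zd.lastMin n ω - min j
      (Zd.lastMin n ω)) - ω (Zd.lastMin n ω))), fun i => twistAt (ω (Zd.lastMin n ω)) (ω (Zd.lastMin n ω + min i
      (n - Zd.lastMin n ω)) - ω (Zd.lastMin n ω)))⟩ : Σ _ : ℕ, (ℕ → Site 2) × (ℕ → Site 2))) ?_ ?_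
  · intro ω hω
    rw [Finset.mem_coe] at hω
    obtain ⟨m, hm⟩ : ∃ m, Zd.lastMin n ω = m := ⟨_, rfl⟩
    have hmn : m ≤ n := hm ▸ Zd.lastMin_le n ω
    rw [Finset.mem_coe, Finset.mem_sigma, Finset.mem_range, Finset.mem_product]
    dsimp only
    simp only [hm]
    refine ⟨Nat.lt_succ_of_le hmn, ?_, ?_⟩
    · -- head: reversed prefix + horizontal step
      refine prep_mem_halfSpaceWalks (revAt_mem hω hmn) fun i hi => ?_
      simp only [twistAt_apply_zero, Pi.sub_apply, Nat.zero_min, Nat.sub_zero, sub_self, Pi.zero_apply,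
        min_eq_left hi, sub_nonneg]
      have := Zd.apply_lastMin_le (n := n) (ω := ω) (i := m - i) (by omega)
      rwa [hm] at this
    · -- tail: twisted suffix, strictly above the last minimum
      have hω' : ω ∈ saws (m + (n - m)) := by rw [Nat.add_sub_cancel' hmn]; exact hω
      refine mem_halfSpaceWalks.2 ⟨suffix_mem hω', fun i h1 h2 => ?_⟩
      simp only [twistAt_apply_zero, Pi.sub_apply, Nat.zero_min, add_zero, sub_self, Pi.zero_apply,
        min_eq_left h2, sub_pos]
      have := Zd.apply_lastMin_lt (n := n) (ω := ω) (i := m + i) (by omega) (by omega)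
      rwa [hm] at this
  · intro ω hω ω' hω' h
    rw [Finset.mem_coe] at hω hω'
    simp only [Sigma.mk.inj_iff] at h
    obtain ⟨hmm, h⟩ := h
    obtain ⟨h0, hend, -, -⟩ := mem_saws_iff.1 hω
    obtain ⟨h0', hend', -, -⟩ := mem_saws_iff.1 hω'
    set m := Zd.lastMin n ω with hm
    have hm' : Zd.lastMin n ω' = m := hmm.symm
    rw [hm'] at h
    have h' := eq_of_heq h
    simp only [Prod.mk.injEq] at h'
    obtain ⟨hh, ht⟩ := h'
    have hmn : m ≤ n := Zd.lastMin_le n ω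
    -- the twists agree: `ω m` and `ω' m` have the parity of `m`
    have hpar : (ω m 0 + ω m 1) % 2 = (ω' m 0 + ω' m 1) % 2 := by
      rw [parity_apply hω hmn, parity_apply hω' (by omega)]
    have htw : ∀ z, twistAt (ω m) z = twistAt (ω' m) z := fun z => twistAt_congr hpar z
    -- recover `ω m` from the reversed prefix at time `m`
    have hrev := prep_injective hh
    have hωm : ω m = ω' m := by
      have := congrFun hrev m
      simp only [min_self, Nat.sub_self, h0, h0', zero_sub, htw] at this
      have h1 := twistAt_injective (ω' m) this
      exact neg_injective h1
    funext i
    rcases le_or_gt i m with hi | hi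
    · have := congrFun hrev (m - i)
      simp only [min_eq_left (Nat.sub_le m i), show m - (m - i) = i by omega, hωm] at this
      have h1 := twistAt_injective (ω' m) this
      rwa [sub_left_inj] at h1
    · rcases le_or_gt i n with hin | hin
      · have := congrFun ht (i - m)
        simp only [min_eq_left (by omega : i - m ≤ n - m), show m + (i - m) = i by omega, hωm] at this
        have h1 := twistAt_injective (ω' m) this
        rwa [sub_left_inj] at h1
      · have := congrFun ht (n - m)
        simp only [min_self, show m + (n - m) = n by omega, hωm] at this
        have h1 := twistAt_injective (ω' m) this
        rw [sub_left_inj] at h1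
        rw [hend i hin.le, hend' i hin.le, h1]

/-! ### Cutting a half-space walk at the last maximum of its height (Madras–Slade (3.1.12) on the brick wall) -/

/-- The head `i ↦ ω (min i M)` of a brick-wall half-space walk up to the last maximum `M` of its height is an `M`-step
brick-wall bridge ending at height `maxLevel`. [cite: MadrasSlade1993, §3.1, proof of Proposition 3.1.5 / Corollary 3.1.8 (eq. (3.1.12))] -/
theorem spanHead_mem_bridges {n : ℕ} {ω : ℕ → Site 2} (hω : ω ∈ halfSpaceWalks n) :
    (fun i => ω (min i (Zd.lastArgmax n ω))) ∈ bridges (Zd.lastArgmax n ω) ∧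
      ω (Zd.lastArgmax n ω) 0 = Zd.maxLevel n ω := by
  have hZ := Zd.spanHead_mem (halfSpaceWalks_subset_zd n hω)
  have hMn : Zd.lastArgmax n ω ≤ n := (Zd.lastArgmax_spec n ω).1
  have hS : ω ∈ saws (Zd.lastArgmax n ω + (n - Zd.lastArgmax n ω)) := by
    rw [Nat.add_sub_cancel' hMn]; exact (mem_halfSpaceWalks.1 hω).1
  exact ⟨mem_bridges.2 ⟨prefix_mem hS, (Zd.mem_bridges.1 hZ.1).2⟩, (Zd.lastArgmax_spec n ω).2⟩

/-- Post-composition with the height reflection `x ↦ −x` preserves brick-wall walks from `0`.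
[cite: MadrasSlade1993, §3.1, proof of Corollary 3.1.8] -/
theorem reflCoord_comp_mem_saws {k : ℕ} {υ : ℕ → Site 2} (hυ : υ ∈ saws k) :
    (fun i => Zd.reflCoord 0 (υ i)) ∈ saws k := by
  obtain ⟨h0, hend, hbw, hinj⟩ := mem_saws_iff.1 hυ
  refine mem_saws_iff.2 ⟨?_, fun i hi => by simp only [hend i hi], fun i hi => adj_reflCoord 0 (hbw i hi),
    fun i hi j hj hij => hinj hi hj (Zd.reflCoord_injective 0 hij)⟩
  rw [h0]
  exact (Zd.reflCoord_eq_self_iff 0 0).2 rfl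

/-- **The reflected, twisted tail after the last maximum is a half-space walk of smaller span**: for a brick-wall
half-space walk `ω` of length `n` with last maximum `M` and span `A = maxLevel ≥ 1`, the walk
`i ↦ R₀ (twistAt (ω M) (ω (M + min i (n-M)) − ω M))` is an `(n-M)`-step brick-wall half-space walk with
`maxLevel < A`. [cite: MadrasSlade1993, §3.1, proof of Corollary 3.1.8 (eq. (3.1.12), "A₁ > A₂ > …")] -/
theorem reflTail_mem {n : ℕ} {ω : ℕ → Site 2} (hω : ω ∈ halfSpaceWalks n) :
    (fun i => Zd.reflCoord 0 (twistAt (ω (Zd.lastArgmax n ω)) (ω (Zd.lastArgmax n ω + min i (n - Zd.lastArgmax n ω)) -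
      ω (Zd.lastArgmax n ω)))) ∈ halfSpaceWalks (n - Zd.lastArgmax n ω) ∧
    (1 ≤ Zd.maxLevel n ω → Zd.maxLevel (n - Zd.lastArgmax n ω) (fun i => Zd.reflCoord 0 (twistAt (ω (Zd.lastArgmax n ω))
      (ω (Zd.lastArgmax n ω + min i (n - Zd.lastArgmax n ω)) - ω (Zd.lastArgmax n ω)))) < Zd.maxLevel n ω) := by
  set M := Zd.lastArgmax n ω with hM
  have hMn : M ≤ n := (Zd.lastArgmax_spec n ω).1
  have hmax : ω M 0 = Zd.maxLevel n ω := (Zd.lastArgmax_spec n ω).2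
  obtain ⟨hωS, hhs⟩ := mem_halfSpaceWalks.1 hω
  obtain ⟨h0, -, -, -⟩ := mem_saws_iff.1 hωS
  have h00 : ω 0 0 = 0 := by rw [h0]; rfl
  have hS : ω ∈ saws (M + (n - M)) := by rw [Nat.add_sub_cancel' hMn]; exact hωS
  have hsaws := reflCoord_comp_mem_saws (suffix_mem hS)
  -- heights of the reflected tail
  have hht : ∀ i, Zd.reflCoord 0 (twistAt (ω M) (ω (M + min i (n - M)) - ω M)) 0 =
      ω M 0 - ω (M + min i (n - M)) 0 := fun i => by
    simp only [Zd.reflCoord_apply_zero, twistAt_apply_zero, Pi.sub_apply]; ring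
  have hlt : ∀ i, M < i → i ≤ n → ω i 0 < ω M 0 := fun i h1 h2 => by
    rw [hmax]; exact Zd.apply_lt_maxLevel_of_lastArgmax_lt ω (hM ▸ h1) h2
  refine ⟨mem_halfSpaceWalks.2 ⟨hsaws, fun i h1 h2 => ?_⟩, fun hA => ?_⟩
  · beta_reduce
    rw [hht, hht, Nat.zero_min, add_zero, sub_self, min_eq_left h2, sub_pos]
    exact hlt (M + i) (by omega) (by omega)
  · refine Int.lt_of_le_sub_one (Zd.maxLevel_le fun i hi => ?_)
    rw [hht, min_eq_left hi]
    rcases Nat.eq_zero_or_pos i with rfl | hipos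
    · rw [add_zero, sub_self, ← hmax]; linarith
    · have := hhs (M + i) (by omega) (by omega)
      rw [h00] at this
      linarith

/-- **The half-space walk is recovered from the cut time and the two pieces.**
[cite: MadrasSlade1993, §3.1, proof of Corollary 3.1.8 ("the sequence of bridges uniquely determines the original half-space walk")] -/
theorem eq_of_span_pieces_eq {n M : ℕ} {ω ω' : ℕ → Site 2} (hω : ω ∈ saws n) (hω' : ω' ∈ saws n) (hMn : M ≤ n)
    (hh : (fun i => ω (min i M)) = fun i => ω' (min i M))
    (ht : (fun i => Zd.reflCoord 0 (twistAt (ω M) (ω (M + min i (n - M)) - ω M))) =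
      fun i => Zd.reflCoord 0 (twistAt (ω' M) (ω' (M + min i (n - M)) - ω' M))) : ω = ω' := by
  obtain ⟨-, hend, -, -⟩ := mem_saws_iff.1 hω
  obtain ⟨-, hend', -, -⟩ := mem_saws_iff.1 hω'
  have hA : ∀ i ≤ M, ω i = ω' i := fun i hi => by
    have := congrFun hh i
    simp only [min_eq_left hi] at this
    exact this
  have hωM : ω M = ω' M := hA M le_rfl
  have hB : ∀ j ≤ n - M, ω (M + j) = ω' (M + j) := fun j hj => by
    have := congrFun ht j
    simp only [min_eq_left hj, hωM] at this
    have h1 := twistAt_injective (ω' M) (Zd.reflCoord_injective 0 this)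
    rwa [sub_left_inj] at h1
  funext i
  rcases le_or_gt i M with hi | hi
  · exact hA i hi
  · rcases le_or_gt i n with hin | hin
    · have := hB (i - M) (by omega)
      rwa [show M + (i - M) = i by omega] at this
    · rw [hend i hin.le, hend' i hin.le]
      have := hB (n - M) le_rfl
      rwa [show M + (n - M) = n by omega] at this

/-- **`h_{n,A} ≤ Σ_{m=0}^{n} b_{m,A} · h^{<A}_{n-m}`** for `A ≥ 1` on the brick wall (the one-step form of Madras–Slade
(3.1.12)): cut a half-space walk of span `A` at the last maximum of its height; the head is a bridge of span `A`
(endpoint height `A`), the reflected twisted tail a half-space walk of span `< A`; injective.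
[cite: MadrasSlade1993, §3.1, proof of Corollary 3.1.8, eq. (3.1.12)] -/
theorem card_hsSpan_le (n : ℕ) {A : ℤ} (hA : 1 ≤ A) :
    #((halfSpaceWalks n).filter fun ω => Zd.maxLevel n ω = A) ≤
      ∑ m ∈ Finset.range (n + 1), #((bridges m).filter fun ω => ω m 0 = A) *
        #((halfSpaceWalks (n - m)).filter fun ω => Zd.maxLevel (n - m) ω < A) := by
  classical
  have hcard : #((Finset.range (n + 1)).sigma fun m => ((bridges m).filter fun ω => ω m 0 = A) ×ˢ
      ((halfSpaceWalks (n - m)).filter fun ω => Zd.maxLevel (n - m) ω < A)) =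
      ∑ m ∈ Finset.range (n + 1), #((bridges m).filter fun ω => ω m 0 = A) *
        #((halfSpaceWalks (n - m)).filter fun ω => Zd.maxLevel (n - m) ω < A) := by
    rw [Finset.card_sigma]; simp_rw [Finset.card_product]
  rw [← hcard]
  refine Finset.card_le_card_of_injOn
    (fun ω => (⟨Zd.lastArgmax n ω, ((fun i => ω (min i (Zd.lastArgmax n ω))),
      fun i => Zd.reflCoord 0 (twistAt (ω (Zd.lastArgmax n ω)) (ω (Zd.lastArgmax n ω + min i (n - Zd.lastArgmax n ω)) -
        ω (Zd.lastArgmax n ω))))⟩ : Σ _ : ℕ, (ℕ → Site 2) × (ℕ → Site 2))) ?_ ?_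
  · intro ω hω
    rw [Finset.mem_coe, Finset.mem_filter] at hω
    obtain ⟨hω, hspan⟩ := hω
    rw [Finset.mem_coe, Finset.mem_sigma, Finset.mem_range, Finset.mem_product, Finset.mem_filter,
      Finset.mem_filter]
    obtain ⟨hhead, hheadA⟩ := spanHead_mem_bridges hω
    obtain ⟨htail, htailA⟩ := reflTail_mem hω
    dsimp only
    refine ⟨Nat.lt_succ_of_le (Zd.lastArgmax_spec n ω).1, ⟨hhead, ?_⟩, htail, ?_⟩
    · simp only [min_self]; rw [hheadA, hspan]
    · rw [← hspan]; exact htailA (hspan ▸ hA)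
  · intro ω hω ω' hω' h
    rw [Finset.mem_coe, Finset.mem_filter] at hω hω'
    simp only [Sigma.mk.inj_iff] at h
    obtain ⟨hmm, h⟩ := h
    have hωS := (mem_halfSpaceWalks.1 hω.1).1
    have hωS' := (mem_halfSpaceWalks.1 hω'.1).1
    set M := Zd.lastArgmax n ω with hM
    have hM' : Zd.lastArgmax n ω' = M := hmm.symm
    rw [hM'] at h
    have h' := eq_of_heq h
    simp only [Prod.mk.injEq] at h'
    exact eq_of_span_pieces_eq hωS hωS' (Zd.lastArgmax_spec n ω).1 h'.1 h'.2

end HexBW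

end Literature.Probability.RandomPlanarGeometry.SAW
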